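import Summits.QuantumFields.YangMills.Theorems.UnitScaleGibbsSchwingerDysonGaussianDomination
import HarnessLib

/-!
# Gross's Gaussian domination for Bałaban's unit-scale Gibbs measure, abstract gauge group — THE MOMENTS AND THE TAILS:
# `∫ X dμ_β = 0`, `∫ X² dμ_β ≤ K∕β`, `μ_β{r ≤ ±X} ≤ exp(−β r²∕(2K))` for every action-derivative observable `X = ∂_u A` with `|∂_u X| ≤ K`

Sequel of `UnitScaleGibbsSchwingerDysonGaussianDomination` (same seat `ym3-torus-px17` gen 7, same data, same namespace; crux of record `UnitScaleTilt.HistoryTailL`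
stmt-QuantumFields-19936, cell `ym3-torus` = YM ladder rung R3 — a RUNG, NOT the Clay problem).  From the Gaussian domination ★★★ `integral_exp_mul_le`
(`∫ e^{sX} dμ_β ≤ e^{Ks²∕(2β)}`, every real `s`, `β > 0`):

* ★ `integral_eq_zero` — `∂_u A` IS CENTRED: `∫ X dμ_β = 0` (the Schwinger–Dyson identity ✓ `integral_shiftDeriv_eq_gibbsMeasure` at `f ≡ 1`; action rows only);
* ★★ `integral_sq_le` — THE VARIANCE BOUND AT THE FREE SCALE `∫ X² dμ_β ≤ K∕β` (two-sided domination as `t → 0⁺`,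
  ✓ `UnitScaleGibbsMGFSecondMoment.integral_sq_mul_weight_le_of_subgaussian_mgf_nhds`, seat px9 g9);
* ★★ `measureReal_le_exp_neg` ∕ ★★ `measureReal_le_neg_le_exp_neg` — THE TWO CHERNOFF TAILS `μ_β{r ≤ X}, μ_β{X ≤ −r} ≤ exp(−β·r²∕(2K))` (`K > 0`, `r ≥ 0`;
  ✓ `UnitScaleGibbsMGFGronwall.measureReal_le_exp_neg_mul_integral_exp_mul_weight` at `t = βr∕K`, seat w8 g9).

THEOREMS ONLY (0 `def`, 0 `sorry`); `--supports stmt-QuantumFields-19936 --as helper`.  HONEST SCOPE as in the parent file: the hypothesis `|Σ_i X′ i| ≤ K` carries the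
physics (crude Hessian bound; the sharp small-field form is LINE 28's S_dom, untouched); nothing of «ShallowFluxSecondMomentL», «BlockSecondMomentL», (Q), K1,
`MeanDeviationL`, `HistoryTailL`, R3, d = 4, a continuum limit or a mass gap is proved; LINE 28 is an idea, not a line; the Yang–Mills mass gap is NOT proved.

References: L. Gross, CMP 92 (1983) 137–162, Thm 2.2 [GrossCMP1983]; S. Chatterjee, CMP 366 (2019) §8 [Chatterjee2019LargeN]; S. Boucheron, G. Lugosi, P. Massart,
Concentration Inequalities (2013) §2.2–§2.3 [BoucheronLugosiMassart2013].
-/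

set_option autoImplicit false

noncomputable section

open MeasureTheory Set Filter Topology
open scoped BigOperators
open Literature.MathematicalPhysics.QuantumFieldTheory.Balaban1983to89
open Literature.MathematicalPhysics.QuantumFieldTheory.Balaban1983to89.T4GenFunBounds (gibbsMeasure isProbabilityMeasure_gibbsMeasure)
open Summit.QuantumFields.YangMills.Theorems.UnitScaleGibbsOneBondSchwingerDyson (update_mul_zero integral_shiftDeriv_eq_gibbsMeasure)
open Summit.QuantumFields.YangMills.Theorems.UnitScaleGibbsMGFGronwall (measureReal_le_exp_neg_mul_integral_exp_mul_weight)
open Summit.QuantumFields.YangMills.Theorems.UnitScaleGibbsMGFSecondMoment (integrable_of_abs_le integral_sq_mul_weight_le_of_subgaussian_mgf_nhds)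

namespace Summit.QuantumFields.YangMills.Theorems.UnitScaleGibbsSchwingerDysonGaussianDomination

variable {P : Params} [DecidableEq (PBond P 0)] {G : Type} [GaugeGroup G] [MeasurableSpace G] [RegularGaugeGroup G] [HaarData G]
variable {ι : Type} [Fintype ι]

/-! ## §4 Mean zero, the variance bound, the Chernoff tails -/

/-- ★ **`∂_u A` IS CENTRED**: `∫ X dμ_β = 0` for `β > 0` (Schwinger–Dyson at the constant observable `f ≡ 1`).  Only the action rows are used.
[cite: Chatterjee2019LargeN, §8] -/
theorem integral_eq_zero {β : ℝ} (hβ : 0 < β)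
    (b : ι → PBond P 0) (k : ι → ℝ → G) (hk : ∀ i s t, k i (s + t) = k i s * k i t)
    (A' : ι → GaugeField P 0 G → ℝ) (hA'm : ∀ i, Measurable (A' i)) (hA'b : ∀ i, ∃ C, ∀ U, |A' i U| ≤ C)
    (hA' : ∀ i U, HasDerivAt (fun t => wilsonAction4 (Function.update U (b i) (k i t * U (b i)))) (A' i U) 0)
    (X : GaugeField P 0 G → ℝ) (hX : ∀ U, X U = ∑ i, A' i U) :
    ∫ U, X U ∂gibbsMeasure P β = 0 := by
  haveI := isProbabilityMeasure_gibbsMeasure (G := G) P hβ.le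
  set μ := gibbsMeasure (G := G) P β with hμ
  choose C hC using hA'b
  have hSD : ∀ i, ∫ U, (fun _ : GaugeField P 0 G => (0 : ℝ)) U ∂μ = β * ∫ U, (fun _ : GaugeField P 0 G => (1 : ℝ)) U * A' i U ∂μ :=
    fun i => integral_shiftDeriv_eq_gibbsMeasure hβ.le (b i) (hk i) (fun _ => (1 : ℝ)) (fun _ => (0 : ℝ)) measurable_const
      measurable_const (Cf := 1) (Cf' := 0) (fun _ => by simp) (fun _ => by simp) (fun U => by simpa using hasDerivAt_const (0 : ℝ) (1 : ℝ))
      (A' i) (hA'm i) (hC i) (hA' i)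
  have hzero : ∀ i, ∫ U, A' i U ∂μ = 0 := fun i => by
    have h := hSD i
    simp only [integral_const, smul_zero, one_mul] at h
    rcases mul_eq_zero.1 h.symm with h1 | h1
    · exact absurd h1 hβ.ne'
    · exact h1
  have hint : ∀ i, Integrable (A' i) μ := fun i => integrable_of_abs_le μ (hA'm i) (hC i)
  calc ∫ U, X U ∂μ = ∫ U, ∑ i, A' i U ∂μ := integral_congr_ae (ae_of_all _ hX)
    _ = ∑ i, ∫ U, A' i U ∂μ := integral_finsetSum _ fun i _ => hint i
    _ = 0 := Finset.sum_eq_zero fun i _ => hzero i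

omit [DecidableEq (PBond P 0)] [MeasurableSpace G] [RegularGaugeGroup G] [HaarData G] in
/-- The hypothesis `|Σ_i X′ i| ≤ K` forces `0 ≤ K` (the configuration space is inhabited). [folklore] -/
theorem nonneg_of_hessianBound (X' : ι → GaugeField P 0 G → ℝ) {K : ℝ} (hK : ∀ U, |∑ i, X' i U| ≤ K) : 0 ≤ K :=
  (abs_nonneg _).trans (hK 1)

/-- ★★ **THE VARIANCE BOUND AT THE FREE SCALE**: `∫ X² dμ_β ≤ K∕β` (`β > 0`; from the two-sided Gaussian domination at `t → 0⁺`,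
✓ `UnitScaleGibbsMGFSecondMoment.integral_sq_mul_weight_le_of_subgaussian_mgf_nhds`; recall `∫ X dμ_β = 0`). [cite: GrossCMP1983, Thm 2.2; BoucheronLugosiMassart2013, §2.3] -/
theorem integral_sq_le {β : ℝ} (hβ : 0 < β)
    (b : ι → PBond P 0) (k : ι → ℝ → G) (hk : ∀ i s t, k i (s + t) = k i s * k i t)
    (A' : ι → GaugeField P 0 G → ℝ) (hA'm : ∀ i, Measurable (A' i)) (hA'b : ∀ i, ∃ C, ∀ U, |A' i U| ≤ C)
    (hA' : ∀ i U, HasDerivAt (fun t => wilsonAction4 (Function.update U (b i) (k i t * U (b i)))) (A' i U) 0)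
    (X : GaugeField P 0 G → ℝ) (hX : ∀ U, X U = ∑ i, A' i U)
    (X' : ι → GaugeField P 0 G → ℝ) (hX'm : ∀ i, Measurable (X' i)) (hX'b : ∀ i, ∃ C, ∀ U, |X' i U| ≤ C)
    (hX' : ∀ i U, HasDerivAt (fun t => X (Function.update U (b i) (k i t * U (b i)))) (X' i U) 0)
    {K : ℝ} (hK : ∀ U, |∑ i, X' i U| ≤ K) :
    ∫ U, X U ^ 2 ∂gibbsMeasure P β ≤ K / β := by
  haveI := isProbabilityMeasure_gibbsMeasure (G := G) P hβ.le
  set μ := gibbsMeasure (G := G) P β with hμ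
  have hXm : Measurable X := measurable_of_eq_sum A' hA'm X hX
  obtain ⟨B, hB0, hXB⟩ := exists_abs_le_of_eq_sum A' hA'b X hX
  have hK0 : 0 ≤ K := nonneg_of_hessianBound X' hK
  have hmgf : ∀ t : ℝ, ∫ U, Real.exp (t * X U) ∂μ ≤ Real.exp (K * t ^ 2 / (2 * β)) := fun t =>
    integral_exp_mul_le hβ b k hk A' hA'm hA'b hA' X hX X' hX'm hX'b hX' hK t
  have h := integral_sq_mul_weight_le_of_subgaussian_mgf_nhds μ hXm measurable_const hXB (χ := fun _ => (1 : ℝ)) (M := 1)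
    (fun _ => zero_le_one) (fun _ => le_rfl) (T := 1) (a := K / β) one_pos (div_nonneg hK0 hβ.le)
    (fun t _ => by
      simp only [mul_one, integral_const, probReal_univ, smul_eq_mul, one_mul]
      calc ∫ U, Real.exp (t * X U) ∂μ ≤ Real.exp (K * t ^ 2 / (2 * β)) := hmgf t
        _ = Real.exp (K / β * t ^ 2 / 2) := by congr 1; field_simp)
    (fun t _ => by
      simp only [mul_one, integral_const, probReal_univ, smul_eq_mul, one_mul]
      calc ∫ U, Real.exp (-t * X U) ∂μ ≤ Real.exp (K * (-t) ^ 2 / (2 * β)) := hmgf (-t)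
        _ = Real.exp (K / β * t ^ 2 / 2) := by rw [neg_sq]; congr 1; field_simp)
  simpa using h

/-- ★★ **THE UPPER CHERNOFF TAIL AT THE FREE SCALE**: for `β > 0`, `K > 0` and `r ≥ 0`, `μ_β{r ≤ X} ≤ exp(−β·r²∕(2K))`
(✓ `UnitScaleGibbsMGFGronwall.measureReal_le_exp_neg_mul_integral_exp_mul_weight` at `t = βr∕K`). [cite: GrossCMP1983, Thm 2.2; BoucheronLugosiMassart2013, §2.2] -/
theorem measureReal_le_exp_neg {β : ℝ} (hβ : 0 < β)
    (b : ι → PBond P 0) (k : ι → ℝ → G) (hk : ∀ i s t, k i (s + t) = k i s * k i t)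
    (A' : ι → GaugeField P 0 G → ℝ) (hA'm : ∀ i, Measurable (A' i)) (hA'b : ∀ i, ∃ C, ∀ U, |A' i U| ≤ C)
    (hA' : ∀ i U, HasDerivAt (fun t => wilsonAction4 (Function.update U (b i) (k i t * U (b i)))) (A' i U) 0)
    (X : GaugeField P 0 G → ℝ) (hX : ∀ U, X U = ∑ i, A' i U)
    (X' : ι → GaugeField P 0 G → ℝ) (hX'm : ∀ i, Measurable (X' i)) (hX'b : ∀ i, ∃ C, ∀ U, |X' i U| ≤ C)
    (hX' : ∀ i U, HasDerivAt (fun t => X (Function.update U (b i) (k i t * U (b i)))) (X' i U) 0)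
    {K : ℝ} (hKpos : 0 < K) (hK : ∀ U, |∑ i, X' i U| ≤ K) {r : ℝ} (hr : 0 ≤ r) :
    (gibbsMeasure (G := G) P β).real {U | r ≤ X U} ≤ Real.exp (-(β * r ^ 2 / (2 * K))) := by
  haveI := isProbabilityMeasure_gibbsMeasure (G := G) P hβ.le
  set μ := gibbsMeasure (G := G) P β with hμ
  have hXm : Measurable X := measurable_of_eq_sum A' hA'm X hX
  obtain ⟨B, hB0, hXB⟩ := exists_abs_le_of_eq_sum A' hA'b X hX
  set t : ℝ := β * r / K with ht
  have ht0 : 0 ≤ t := div_nonneg (mul_nonneg hβ.le hr) hKpos.le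
  have hcher := measureReal_le_exp_neg_mul_integral_exp_mul_weight μ hXm measurable_const hXB (χ := fun _ => (1 : ℝ)) (M := 1)
    (fun _ => by simp) (fun _ => zero_le_one) ht0 r
  have hset : {U : GaugeField P 0 G | r ≤ X U ∧ (fun _ : GaugeField P 0 G => (1 : ℝ)) U = 1} = {U | r ≤ X U} := by
    ext U; simp
  rw [hset] at hcher
  simp only [mul_one] at hcher
  have hmgf := integral_exp_mul_le hβ b k hk A' hA'm hA'b hA' X hX X' hX'm hX'b hX' hK t
  calc μ.real {U | r ≤ X U} ≤ Real.exp (-(t * r)) * ∫ U, Real.exp (t * X U) ∂μ := hcher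
    _ ≤ Real.exp (-(t * r)) * Real.exp (K * t ^ 2 / (2 * β)) := mul_le_mul_of_nonneg_left hmgf (Real.exp_pos _).le
    _ = Real.exp (-(β * r ^ 2 / (2 * K))) := by
        rw [← Real.exp_add]; congr 1; rw [ht]; field_simp; ring

/-- ★★ **THE LOWER CHERNOFF TAIL**: `μ_β{X ≤ −r} ≤ exp(−β·r²∕(2K))` (the domination at `s = −βr∕K`). [cite: GrossCMP1983, Thm 2.2; BoucheronLugosiMassart2013, §2.2] -/
theorem measureReal_le_neg_le_exp_neg {β : ℝ} (hβ : 0 < β)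
    (b : ι → PBond P 0) (k : ι → ℝ → G) (hk : ∀ i s t, k i (s + t) = k i s * k i t)
    (A' : ι → GaugeField P 0 G → ℝ) (hA'm : ∀ i, Measurable (A' i)) (hA'b : ∀ i, ∃ C, ∀ U, |A' i U| ≤ C)
    (hA' : ∀ i U, HasDerivAt (fun t => wilsonAction4 (Function.update U (b i) (k i t * U (b i)))) (A' i U) 0)
    (X : GaugeField P 0 G → ℝ) (hX : ∀ U, X U = ∑ i, A' i U)
    (X' : ι → GaugeField P 0 G → ℝ) (hX'm : ∀ i, Measurable (X' i)) (hX'b : ∀ i, ∃ C, ∀ U, |X' i U| ≤ C)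
    (hX' : ∀ i U, HasDerivAt (fun t => X (Function.update U (b i) (k i t * U (b i)))) (X' i U) 0)
    {K : ℝ} (hKpos : 0 < K) (hK : ∀ U, |∑ i, X' i U| ≤ K) {r : ℝ} (hr : 0 ≤ r) :
    (gibbsMeasure (G := G) P β).real {U | X U ≤ -r} ≤ Real.exp (-(β * r ^ 2 / (2 * K))) := by
  haveI := isProbabilityMeasure_gibbsMeasure (G := G) P hβ.le
  set μ := gibbsMeasure (G := G) P β with hμ
  have hXm : Measurable X := measurable_of_eq_sum A' hA'm X hX
  obtain ⟨B, hB0, hXB⟩ := exists_abs_le_of_eq_sum A' hA'b X hX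
  have hXm' : Measurable (fun U => -X U) := hXm.neg
  have hXB' : ∀ U, |(fun U => -X U) U| ≤ B := fun U => by simp only [abs_neg]; exact hXB U
  set t : ℝ := β * r / K with ht
  have ht0 : 0 ≤ t := div_nonneg (mul_nonneg hβ.le hr) hKpos.le
  have hcher := measureReal_le_exp_neg_mul_integral_exp_mul_weight μ hXm' measurable_const hXB' (χ := fun _ => (1 : ℝ)) (M := 1)
    (fun _ => by simp) (fun _ => zero_le_one) ht0 r
  have hset : {U : GaugeField P 0 G | r ≤ (fun U => -X U) U ∧ (fun _ : GaugeField P 0 G => (1 : ℝ)) U = 1} = {U | X U ≤ -r} := by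
    ext U
    simp only [mem_setOf_eq, and_true]
    constructor <;> intro h <;> linarith
  rw [hset] at hcher
  simp only [mul_one] at hcher
  have hmgf := integral_exp_mul_le hβ b k hk A' hA'm hA'b hA' X hX X' hX'm hX'b hX' hK (-t)
  have he : ∀ U, Real.exp (t * -X U) = Real.exp (-t * X U) := fun U => by ring_nf
  simp only [he] at hcher
  calc μ.real {U | X U ≤ -r} ≤ Real.exp (-(t * r)) * ∫ U, Real.exp (-t * X U) ∂μ := hcher
    _ ≤ Real.exp (-(t * r)) * Real.exp (K * (-t) ^ 2 / (2 * β)) := mul_le_mul_of_nonneg_left hmgf (Real.exp_pos _).le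
    _ = Real.exp (-(β * r ^ 2 / (2 * K))) := by
        rw [← Real.exp_add, neg_sq]; congr 1; rw [ht]; field_simp; ring

end Summit.QuantumFields.YangMills.Theorems.UnitScaleGibbsSchwingerDysonGaussianDomination

end
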